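/-
Fleet lead `ym-wcr-19609-p1` (seat prover-ym-wcr-19609-p1-g2-0), route `WeakCouplingRates`, crux `BulkDominatesColdBoxW`
(stmt-QuantumFields-19609), line `dlr-chessboard` (v4), bricks M3 of the census v3 (item evidence #12).
-/
import Summits.QuantumFields.YangMills.Theorems.WeakCouplingRatesDirichletHodge

/-!
# Crux `BulkDominatesColdBoxW`, stubs L1a/L1b: the BACKGROUND of a boundary datum in the temporal-gauge Dirichlet problem —
# completing the square without the comb hypothesis, normal equations on ALL cold-box edges, harmonic components, energy bound

Census v3 of the line `dlr-chessboard` (item evidence #12, `FINDING-19609-census-v3.md`): uniformly over crude-good boundary data the box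
kernel linearises around the FLAT configuration, and the datum `θ` (chart coordinates of the exterior collar links, one colour component)
enters only through the MEAN SHIFT `μ_θ = LatticeMaxwell.mean` of the datum-independent Dirichlet Gaussian `boxDirichlet H` (D1').  The
background circulation of the datum is `F̄_p = sCirc (glue θ μ_θ) p = λ_p · μ_θ + b_p(θ)`.  This file proves its finite-dimensional
properties, in the vocabulary of Chatterjee's §14 apparatus (`Literature/…/LatticeMaxwellGaussian.lean`):

* §1 (general pinned box, hypothesis `Q.PosDef` instead of «comb pinned»): completing the square `formM_eq_sq_of_posDef`,
  `Qmat_mulVec_mean` (`Q μ = −v_θ`), `formM_mean_eq_Kconst`, the energy bound `Kconst_le_formM_of_posDef` (`K_θ = min M_θ`), and the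
  NORMAL EQUATIONS `sum_sCirc_mean_mul_coeff_eq_zero` (`Σ_p F̄_p (λ_p · s) = 0` for every free `s`);
* §2 (the Dirichlet box, `posDef_dirQmat`): by the forest gauge (`exists_dirFree_curl_eq`) the background is orthogonal to the curls of ALL
  edge functions supported on the cold box (`sum_dirBackground_mul_d₁_eq_zero`), hence `div₂ F̄ = 0` on every cold-box edge
  (`div₂_dirBackground_eq_zero`, summation by parts `LatticeChain.pair₁_div₂`), hence — `F̄` being a curl, `d₂ F̄ = 0` — by the lattice Hodge identity
  `LatticeChain.div₃_d₂_add_d₁_div₂` every component `z ↦ F̄(z; k, l)` is `latticeLaplacianZd`-HARMONIC at each base point whose plaquette has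
  its four edges in the cold box (`latticeLaplacianZd_dirBackground_eq_zero`);
* §3 the energy of the background is at most that of any competitor (`sum_dirBackground_sq_le_formM`).

The interior sup/gradient bounds near the centre (via `Beta.PoissonInterior.interior_estimate`) are the next file.  No new definition;
standard axioms.  NOT a claim about the mass gap.
-/

set_option autoImplicit false

noncomputable section

open Finset Matrix
open Literature.Probability.LatticeModels
open Literature.MathematicalPhysics.QuantumLattice
open Literature.MathematicalPhysics.QuantumFieldTheory
open Literature.MathematicalPhysics.QuantumFieldTheory.LatticeMaxwell
open Literature.MathematicalPhysics.QuantumFieldTheory.AxialGauge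
open Literature.MathematicalPhysics.QuantumFieldTheory.LatticeChain
open Literature.MathematicalPhysics.QuantumFieldTheory.LatticeForm (e d₀ d₁ d₂ d₁_d₀ d₂_d₁ d₁_swap d₁_sub)

namespace Summit.QuantumFields.YangMills.Theorems.WeakCouplingRates

/-! ## §1 Completing the square for a general pinned box with positive definite precision matrix -/

section General

variable {d : ℕ} {pin : Literature.MathematicalPhysics.QuantumLattice.ZdEdge d → Prop} [DecidablePred pin]
  {a : Site d} {n : ℕ}

/-- The bilinear form of the precision matrix: `u · Q s = Σ_p (λ_{a+p} · u)(λ_{a+p} · s)`. -/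
theorem dotProduct_Qmat_mulVec_bilin (u s : LatticeMaxwell.Free pin a n → ℝ) :
    u ⬝ᵥ Qmat pin a n *ᵥ s =
      ∑ p ∈ plaquettesIn (halfOpenBox d n), (coeff pin a n (Plaq.shift a p) ⬝ᵥ u) * (coeff pin a n (Plaq.shift a p) ⬝ᵥ s) := by
  rw [Qmat, Matrix.sum_mulVec, dotProduct_sum]
  refine Finset.sum_congr rfl fun p _ => ?_
  have h1 : vecMulVec (coeff pin a n (Plaq.shift a p)) (coeff pin a n (Plaq.shift a p)) *ᵥ s =
      (coeff pin a n (Plaq.shift a p) ⬝ᵥ s) • coeff pin a n (Plaq.shift a p) := by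
    ext i
    simp only [Matrix.mulVec, vecMulVec_apply, dotProduct, Pi.smul_apply, smul_eq_mul, Finset.sum_mul]
    exact Finset.sum_congr rfl fun j _ => by ring
  rw [h1, dotProduct_smul, smul_eq_mul, dotProduct_comm u, mul_comm]

/-- `Q μ_θ = −v_θ` whenever `Q` is positive definite (hence invertible). -/
theorem Qmat_mulVec_mean (hQ : (Qmat pin a n).PosDef) (θ : Literature.MathematicalPhysics.QuantumLattice.ZdEdge d → ℝ) :
    Qmat pin a n *ᵥ mean pin a n θ = -vvec pin a n θ := by
  have hu := (Matrix.isUnit_iff_isUnit_det _).1 hQ.isUnit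
  rw [mean, Matrix.mulVec_neg, Matrix.mulVec_mulVec, Matrix.mul_nonsing_inv _ hu, Matrix.one_mulVec]

/-- **Completing the square** for a positive definite precision matrix (the tree's `LatticeMaxwell.formM_eq_sq` with the comb
hypothesis replaced by `Q.PosDef`): `M_θ(s) = (s − μ_θ)ᵀ Q (s − μ_θ) + K_θ`. -/
theorem formM_eq_sq_of_posDef (hQ : (Qmat pin a n).PosDef) (θ : Literature.MathematicalPhysics.QuantumLattice.ZdEdge d → ℝ)
    (s : LatticeMaxwell.Free pin a n → ℝ) :
    formM pin a n θ s = (s - mean pin a n θ) ⬝ᵥ Qmat pin a n *ᵥ (s - mean pin a n θ) + Kconst pin a n θ := by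
  set Q := Qmat pin a n with hQdef
  set v := vvec pin a n θ with hv
  set m := mean pin a n θ with hm
  have hQm : Q *ᵥ m = -v := Qmat_mulVec_mean hQ θ
  have hlin : ∑ p ∈ plaquettesIn (halfOpenBox d n), bterm pin a n θ (Plaq.shift a p) * (coeff pin a n (Plaq.shift a p) ⬝ᵥ s) =
      v ⬝ᵥ s := by
    rw [hv, vvec, sum_dotProduct]
    exact Finset.sum_congr rfl fun p _ => by rw [smul_dotProduct, smul_eq_mul]
  have hexp : formM pin a n θ s = s ⬝ᵥ Q *ᵥ s + 2 * (v ⬝ᵥ s) +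
      ∑ p ∈ plaquettesIn (halfOpenBox d n), bterm pin a n θ (Plaq.shift a p) ^ 2 := by
    rw [formM_eq, dotProduct_Qmat_mulVec, formM_zero_eq, ← hlin, Finset.mul_sum, ← Finset.sum_add_distrib,
      ← Finset.sum_add_distrib]
    exact Finset.sum_congr rfl fun p _ => by ring
  have hsq : (s - m) ⬝ᵥ Q *ᵥ (s - m) = s ⬝ᵥ Q *ᵥ s + 2 * (v ⬝ᵥ s) + m ⬝ᵥ Q *ᵥ m := by
    have h1 : s ⬝ᵥ Q *ᵥ m = -(v ⬝ᵥ s) := by rw [hQm, dotProduct_neg, dotProduct_comm]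
    have h2 : m ⬝ᵥ Q *ᵥ s = -(v ⬝ᵥ s) := by
      rw [Matrix.dotProduct_mulVec, ← Matrix.mulVec_transpose, Qmat_transpose, ← hQdef, hQm, neg_dotProduct]
    rw [Matrix.mulVec_sub, sub_dotProduct, dotProduct_sub, dotProduct_sub, h1, h2]
    ring
  rw [hexp, hsq, Kconst, ← hm, ← hQdef]
  ring

/-- The value of the form at the mean is the constant `K_θ`. -/
theorem formM_mean_eq_Kconst (hQ : (Qmat pin a n).PosDef) (θ : Literature.MathematicalPhysics.QuantumLattice.ZdEdge d → ℝ) :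
    formM pin a n θ (mean pin a n θ) = Kconst pin a n θ := by
  rw [formM_eq_sq_of_posDef hQ, sub_self, Matrix.mulVec_zero, dotProduct_zero, zero_add]

/-- **Energy minimality of the background**: `K_θ ≤ M_θ(s)` for every free `s`. -/
theorem Kconst_le_formM_of_posDef (hQ : (Qmat pin a n).PosDef) (θ : Literature.MathematicalPhysics.QuantumLattice.ZdEdge d → ℝ)
    (s : LatticeMaxwell.Free pin a n → ℝ) : Kconst pin a n θ ≤ formM pin a n θ s := by
  rw [formM_eq_sq_of_posDef hQ θ s]
  have h := hQ.posSemidef.dotProduct_mulVec_nonneg (s - mean pin a n θ)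
  simp only [star_trivial] at h
  linarith

/-- `K_θ` is the energy `Σ_p F̄_p²` of the background circulation `F̄_p = sCirc (glue θ μ_θ) p`. -/
theorem Kconst_eq_sum_sCirc_sq (hQ : (Qmat pin a n).PosDef) (θ : Literature.MathematicalPhysics.QuantumLattice.ZdEdge d → ℝ) :
    Kconst pin a n θ = ∑ p ∈ plaquettesIn (halfOpenBox d n),
      sCirc (LatticeMaxwell.glue (pin := pin) a n θ (mean pin a n θ)) (Plaq.shift a p) ^ 2 := by
  rw [← formM_mean_eq_Kconst hQ]; rfl

/-- **The normal equations** of the Dirichlet problem with datum `θ`: the background circulation is orthogonal to every free curl,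
`Σ_p F̄_{a+p} · (λ_{a+p} · s) = 0`. -/
theorem sum_sCirc_mean_mul_coeff_eq_zero (hQ : (Qmat pin a n).PosDef) (θ : Literature.MathematicalPhysics.QuantumLattice.ZdEdge d → ℝ)
    (s : LatticeMaxwell.Free pin a n → ℝ) :
    ∑ p ∈ plaquettesIn (halfOpenBox d n),
      sCirc (LatticeMaxwell.glue (pin := pin) a n θ (mean pin a n θ)) (Plaq.shift a p) * (coeff pin a n (Plaq.shift a p) ⬝ᵥ s) = 0 := by
  set m := mean pin a n θ with hm
  have hsplit : ∑ p ∈ plaquettesIn (halfOpenBox d n),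
      sCirc (LatticeMaxwell.glue (pin := pin) a n θ m) (Plaq.shift a p) * (coeff pin a n (Plaq.shift a p) ⬝ᵥ s) =
      m ⬝ᵥ Qmat pin a n *ᵥ s + vvec pin a n θ ⬝ᵥ s := by
    rw [dotProduct_Qmat_mulVec_bilin, vvec, sum_dotProduct, ← Finset.sum_add_distrib]
    refine Finset.sum_congr rfl fun p _ => ?_
    rw [sCirc_glue, smul_dotProduct, smul_eq_mul]
    ring
  rw [hsplit, Matrix.dotProduct_mulVec, ← Matrix.mulVec_transpose, Qmat_transpose, hm, Qmat_mulVec_mean hQ, neg_dotProduct]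
  ring

end General

/-! ## §2 The Dirichlet box: orthogonality to all cold-box curls, `div₂ F̄ = 0` on cold-box edges, harmonic components -/

section Dirichlet

variable (H : ℕ) (θ : Literature.MathematicalPhysics.QuantumLattice.ZdEdge 4 → ℝ)

/-- Membership in the enlarged vertex box `{−1,…,2H+1}⁴ = dirCorner + {0,…,2H+2}⁴`. -/
theorem mem_enlargedBox_iff {H : ℕ} {w : Site 4} :
    w ∈ (halfOpenBox 4 (2 * H + 3)).image (· + dirCorner) ↔ ∀ m : Fin 4, -1 ≤ w m ∧ w m ≤ 2 * (H : ℤ) + 1 := by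
  rw [Finset.mem_image]
  constructor
  · rintro ⟨x, hx, rfl⟩ m
    rw [mem_halfOpenBox] at hx
    have := hx m
    simp only [Pi.add_apply, dirCorner]
    push_cast at this ⊢; omega
  · intro hw
    refine ⟨w - dirCorner, ?_, sub_add_cancel w dirCorner⟩
    rw [mem_halfOpenBox]
    intro m
    have := hw m
    simp only [Pi.sub_apply, dirCorner]
    push_cast; omega

/-- A positively oriented plaquette whose base point has all coordinates in `[−1, 2H]` is a plaquette of the enlarged box. -/
theorem mem_plaquettesIn_enlarged {H : ℕ} {z : Site 4} {i j : Fin 4} (hij : i < j)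
    (hz : ∀ m : Fin 4, -1 ≤ z m ∧ z m ≤ 2 * (H : ℤ)) :
    ((z, i, j) : Plaq 4) ∈ plaquettesIn ((halfOpenBox 4 (2 * H + 3)).image (· + dirCorner)) := by
  rw [Plaq.mem_plaquettesIn]
  refine ⟨?_, hij, ?_, ?_, ?_⟩ <;> rw [mem_enlargedBox_iff] <;> intro m <;> have := hz m
  · dsimp only; omega
  · simp only [Pi.add_apply, Pi.single_apply]; split_ifs <;> omega
  · simp only [Pi.add_apply, Pi.single_apply]; split_ifs <;> omega
  · simp only [Pi.add_apply, Pi.single_apply]; split_ifs <;> omega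

/-- **The background is orthogonal to the curls of ALL edge functions supported on the cold box** (not only the free Dirichlet
ones): `Σ_p F̄_{a+p} · (d₁ φ)(a+p) = 0`, by the normal equations and the forest gauge `exists_dirFree_curl_eq`. -/
theorem sum_dirBackground_mul_d₁_eq_zero (φ : Site 4 → Fin 4 → ℝ)
    (hφ : ∀ x i, φ x i ≠ 0 → (x, i) ∈ boxEdges 4 (2 * H + 1)) :
    ∑ p ∈ plaquettesIn (halfOpenBox 4 (2 * H + 3)),
      sCirc (LatticeMaxwell.glue (pin := fun e => e ∉ dirFreeEdges H) dirCorner (2 * H + 3) θ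
          (mean (fun e => e ∉ dirFreeEdges H) dirCorner (2 * H + 3) θ)) (Plaq.shift dirCorner p) *
        d₁ φ (Plaq.shift dirCorner p).1 (Plaq.shift dirCorner p).2.1 (Plaq.shift dirCorner p).2.2 = 0 := by
  obtain ⟨s, hs⟩ := exists_dirFree_curl_eq H φ hφ
  simp_rw [← hs]
  exact sum_sCirc_mean_mul_coeff_eq_zero (posDef_dirQmat H) θ s

/-- The glued edge function of the Dirichlet problem (datum `θ` on the pinned edges, the background free values inside) is supported in
the enlarged box. -/
theorem hasFiniteSupport_dirGlued (s : DirFree H → ℝ) :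
    Function.HasFiniteSupport (fun x (i : Fin 4) =>
      LatticeMaxwell.glue (pin := fun e => e ∉ dirFreeEdges H) dirCorner (2 * H + 3) θ s (x, i)) := by
  refine (((halfOpenBox 4 (2 * H + 3)).image (· + dirCorner)).finite_toSet).subset fun x hx => ?_
  simp only [Function.mem_support, ne_eq] at hx
  simp only [Finset.mem_coe]
  by_contra hcon
  apply hx
  funext i
  have hmem : (x, i) ∉ boxEdgesAt dirCorner (2 * H + 3) := by
    intro h
    apply hcon
    rw [mem_boxEdgesAt, mem_boxEdges] at h
    exact Finset.mem_image.2 ⟨x - dirCorner, h.1, sub_add_cancel x dirCorner⟩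
  exact glue_apply_of_not_mem _ _ hmem

/-- **`div₂ F̄ = 0` on every edge of the cold box** (free or forest): the backward divergence of the background circulation
`F̄ = d₁ ψ̄` (`ψ̄` = the glued edge function of the datum and the background free values) vanishes on `boxEdges 4 (2H+1)`.
Summation by parts (`LatticeChain.pair₁_div₂`) against the indicator of the edge, whose curl lives on plaquettes of the enlarged box,
plus `sum_dirBackground_mul_d₁_eq_zero`. -/
theorem div₂_dirBackground_eq_zero {y : Site 4} {k : Fin 4} (he : (y, k) ∈ boxEdges 4 (2 * H + 1)) :
    div₂ (d₁ fun x (i : Fin 4) =>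
        LatticeMaxwell.glue (pin := fun e => e ∉ dirFreeEdges H) dirCorner (2 * H + 3) θ
          (mean (fun e => e ∉ dirFreeEdges H) dirCorner (2 * H + 3) θ) (x, i)) y k = 0 := by
  classical
  set ψ : Site 4 → Fin 4 → ℝ := fun x i =>
    LatticeMaxwell.glue (pin := fun e => e ∉ dirFreeEdges H) dirCorner (2 * H + 3) θ
      (mean (fun e => e ∉ dirFreeEdges H) dirCorner (2 * H + 3) θ) (x, i) with hψ
  set φ : Site 4 → Fin 4 → ℝ := fun x i => if x = y ∧ i = k then 1 else 0 with hφdef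
  have hy := mem_boxEdges_iff.1 he
  -- `φ` is supported on the edge `(y, k)` of the cold box
  have hφ : ∀ x i, φ x i ≠ 0 → (x, i) ∈ boxEdges 4 (2 * H + 1) := by
    intro x i h
    simp only [hφdef, ne_eq, ite_eq_right_iff, one_ne_zero, imp_false, not_not] at h
    obtain ⟨rfl, rfl⟩ := h
    exact he
  have hφval : ∀ x i, φ x i ≠ 0 → x = y ∧ i = k := by
    intro x i h
    simp only [hφdef, ne_eq, ite_eq_right_iff, one_ne_zero, imp_false, not_not] at h
    exact h
  -- finite support and alternation
  have hfin : Function.HasFiniteSupport (d₁ ψ) :=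
    hasFiniteSupport_d₁ (hasFiniteSupport_dirGlued H θ (mean (fun e => e ∉ dirFreeEdges H) dirCorner (2 * H + 3) θ))
  have halt : IsAltR₂ (d₁ ψ) := fun z i j => d₁_swap ψ z i j
  have haltφ : ∀ z i j, d₁ φ z j i = -d₁ φ z i j := fun z i j => d₁_swap φ z i j
  -- the curl of `φ` lives on plaquettes of the enlarged box
  set Λ' := (halfOpenBox 4 (2 * H + 3)).image (· + dirCorner) with hΛ'
  have hsuppφ : ∀ z i j, d₁ φ z i j ≠ 0 → ((z, i, j) : Plaq 4) ∈ plaquettesIn Λ' ∨ ((z, j, i) : Plaq 4) ∈ plaquettesIn Λ' := by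
    intro z i j h
    have hij : i ≠ j := by rintro rfl; exact h (LatticeForm.d₁_self φ z i)
    -- the base point `z` is `y`, `y − eᵢ` or `y − eⱼ`
    have hz : ∀ m : Fin 4, -1 ≤ z m ∧ z m ≤ 2 * (H : ℤ) := by
      have h' : φ z i ≠ 0 ∨ φ (z + e i) j ≠ 0 ∨ φ (z + e j) i ≠ 0 ∨ φ z j ≠ 0 := by
        by_contra hcon
        push Not at hcon
        obtain ⟨h1, h2, h3, h4⟩ := hcon
        apply h
        simp only [LatticeForm.d₁, h1, h2, h3, h4]; ring
      intro m
      have hym := (hy.1 m)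
      rcases h' with h' | h' | h' | h'
      · obtain ⟨rfl, -⟩ := hφval _ _ h'
        omega
      · obtain ⟨hzy, -⟩ := hφval _ _ h'
        have : z m = y m - (e i : Site 4) m := by rw [← hzy]; simp
        rw [this]; simp only [LatticeForm.e, Pi.single_apply]; split_ifs <;> omega
      · obtain ⟨hzy, -⟩ := hφval _ _ h'
        have : z m = y m - (e j : Site 4) m := by rw [← hzy]; simp
        rw [this]; simp only [LatticeForm.e, Pi.single_apply]; split_ifs <;> omega
      · obtain ⟨rfl, -⟩ := hφval _ _ h'
        omega
    rcases lt_or_gt_of_ne hij with hlt | hlt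
    · exact Or.inl (mem_plaquettesIn_enlarged hlt hz)
    · exact Or.inr (mem_plaquettesIn_enlarged hlt hz)
  -- evaluation of the pairing with the indicator
  have h1 : pair₁ (div₂ (d₁ ψ)) φ = div₂ (d₁ ψ) y k := by
    rw [pair₁, tsum_eq_single y]
    · rw [Finset.sum_eq_single k]
      · simp [hφdef]
      · intro i _ hik; simp [hφdef, hik]
      · intro hk; exact absurd (Finset.mem_univ k) hk
    · intro z hz
      refine Finset.sum_eq_zero fun i _ => ?_
      simp [hφdef, hz]
  -- summation by parts and the normal equations on all cold-box curls
  have h2 : pair₁ (div₂ (d₁ ψ)) φ = pair₂ (d₁ ψ) (d₁ φ) := pair₁_div₂ hfin halt φ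
  have h3 : pair₂ (d₁ ψ) (d₁ φ) =
      ∑ p : ↥(plaquettesIn Λ'), ofChain Λ' (d₁ φ) p * d₁ ψ (p : Plaq 4).1 (p : Plaq 4).2.1 (p : Plaq 4).2.2 := by
    rw [pair₂_comm, ← pair₂_fluxChain_left (ofChain Λ' (d₁ φ)) halt, fluxChain_ofChain haltφ hsuppφ]
  have h4 : ∑ p : ↥(plaquettesIn Λ'), ofChain Λ' (d₁ φ) p * d₁ ψ (p : Plaq 4).1 (p : Plaq 4).2.1 (p : Plaq 4).2.2 =
      ∑ p ∈ plaquettesIn Λ', d₁ φ p.1 p.2.1 p.2.2 * d₁ ψ p.1 p.2.1 p.2.2 := by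
    simp only [ofChain]
    exact Finset.sum_coe_sort (plaquettesIn Λ') (fun p : Plaq 4 => d₁ φ p.1 p.2.1 p.2.2 * d₁ ψ p.1 p.2.1 p.2.2)
  have h5 : ∑ p ∈ plaquettesIn Λ', d₁ φ p.1 p.2.1 p.2.2 * d₁ ψ p.1 p.2.1 p.2.2 = 0 := by
    rw [hΛ', ← sum_shift_eq (F := fun p : Plaq 4 => d₁ φ p.1 p.2.1 p.2.2 * d₁ ψ p.1 p.2.1 p.2.2)]
    have h0 := sum_dirBackground_mul_d₁_eq_zero H θ φ hφ
    rw [← h0]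
    refine Finset.sum_congr rfl fun p _ => ?_
    rw [sCirc_eq_d₁, mul_comm]
  rw [← h1, h2, h3, h4, h5]

/-- **Harmonic components.**  At a base point `y` whose plaquette `(y; k, l)` has its four edges in the cold box, the component
`z ↦ F̄(z; k, l)` of the background circulation is `latticeLaplacianZd`-harmonic: `F̄ = d₁ψ̄` is a curl (`d₂ F̄ = 0`), so the lattice
Hodge identity `div₃ d₂ + d₁ div₂ = −Δ` reduces `−ΔF̄ (y;k,l)` to the four edge divergences, which vanish. -/
theorem latticeLaplacianZd_dirBackground_eq_zero {y : Site 4} {k l : Fin 4}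
    (h₁ : (y, k) ∈ boxEdges 4 (2 * H + 1)) (h₂ : (y + e k, l) ∈ boxEdges 4 (2 * H + 1))
    (h₃ : (y + e l, k) ∈ boxEdges 4 (2 * H + 1)) (h₄ : (y, l) ∈ boxEdges 4 (2 * H + 1)) :
    latticeLaplacianZd (fun z => d₁ (fun x (i : Fin 4) =>
        LatticeMaxwell.glue (pin := fun e => e ∉ dirFreeEdges H) dirCorner (2 * H + 3) θ
          (mean (fun e => e ∉ dirFreeEdges H) dirCorner (2 * H + 3) θ) (x, i)) z k l) y = 0 := by
  set ψ : Site 4 → Fin 4 → ℝ := fun x i =>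
    LatticeMaxwell.glue (pin := fun e => e ∉ dirFreeEdges H) dirCorner (2 * H + 3) θ
      (mean (fun e => e ∉ dirFreeEdges H) dirCorner (2 * H + 3) θ) (x, i) with hψ
  have hH := congrFun (congrFun (congrFun (div₃_d₂_add_d₁_div₂ (d₁ ψ)) y) k) l
  rw [d₂_d₁] at hH
  have hdiv0 : div₃ (0 : Site 4 → Fin 4 → Fin 4 → Fin 4 → ℝ) y k l = 0 := by simp [div₃]
  simp only [Pi.add_apply, hdiv0, zero_add] at hH
  have hneg : negLap₂ (d₁ ψ) y k l = -latticeLaplacianZd (fun z => d₁ ψ z k l) y := by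
    rw [← sum_sub_add_sub_eq_neg_latticeLaplacianZd]; rfl
  have hd : d₁ (div₂ (d₁ ψ)) y k l = 0 := by
    simp only [LatticeForm.d₁]
    rw [div₂_dirBackground_eq_zero H θ h₁, div₂_dirBackground_eq_zero H θ h₂, div₂_dirBackground_eq_zero H θ h₃,
      div₂_dirBackground_eq_zero H θ h₄]
    ring
  rw [hd, hneg] at hH
  linarith

/-- Coordinate form of the harmonicity: every base point `y` with all coordinates in `[0, 2H−1]` qualifies, for `k ≠ l`;
for `k = l` the component is identically zero. -/
theorem latticeLaplacianZd_dirBackground_eq_zero_of_coords {y : Site 4} (k l : Fin 4)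
    (hy : ∀ m : Fin 4, 0 ≤ y m ∧ y m ≤ 2 * (H : ℤ) - 1) :
    latticeLaplacianZd (fun z => d₁ (fun x (i : Fin 4) =>
        LatticeMaxwell.glue (pin := fun e => e ∉ dirFreeEdges H) dirCorner (2 * H + 3) θ
          (mean (fun e => e ∉ dirFreeEdges H) dirCorner (2 * H + 3) θ) (x, i)) z k l) y = 0 := by
  by_cases hkl : k = l
  · subst hkl
    simp only [LatticeForm.d₁_self]
    simp [latticeLaplacianZd]
  · refine latticeLaplacianZd_dirBackground_eq_zero H θ ?_ ?_ ?_ ?_ <;> rw [mem_boxEdges_iff]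
    · exact ⟨fun m => by have := hy m; omega, by have := hy k; omega⟩
    · refine ⟨fun m => ?_, ?_⟩
      · have := hy m; simp only [Pi.add_apply, LatticeForm.e, Pi.single_apply]; split_ifs <;> omega
      · have := hy l
        have hne : l ≠ k := fun h => hkl h.symm
        simp only [Pi.add_apply, LatticeForm.e, Pi.single_eq_of_ne hne]; omega
    · refine ⟨fun m => ?_, ?_⟩
      · have := hy m; simp only [Pi.add_apply, LatticeForm.e, Pi.single_apply]; split_ifs <;> omega
      · have := hy k
        simp only [Pi.add_apply, LatticeForm.e, Pi.single_eq_of_ne hkl]; omega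
    · exact ⟨fun m => by have := hy m; omega, by have := hy l; omega⟩

/-! ## §3 The energy of the background is minimal -/

/-- **Energy bound**: the energy `Σ_p F̄_{a+p}²` of the background circulation of the datum `θ` is at most `M_θ(s)` for EVERY free
competitor `s` (it is the minimum `K_θ`). -/
theorem sum_dirBackground_sq_le_formM (s : DirFree H → ℝ) :
    ∑ p ∈ plaquettesIn (halfOpenBox 4 (2 * H + 3)),
      sCirc (LatticeMaxwell.glue (pin := fun e => e ∉ dirFreeEdges H) dirCorner (2 * H + 3) θ
          (mean (fun e => e ∉ dirFreeEdges H) dirCorner (2 * H + 3) θ)) (Plaq.shift dirCorner p) ^ 2 ≤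
      formM (fun e => e ∉ dirFreeEdges H) dirCorner (2 * H + 3) θ s := by
  rw [← Kconst_eq_sum_sCirc_sq (posDef_dirQmat H)]
  exact Kconst_le_formM_of_posDef (posDef_dirQmat H) θ s

end Dirichlet

end Summit.QuantumFields.YangMills.Theorems.WeakCouplingRates

end
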